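import Summits.QuantumFields.YangMills.Theorems.LangevinControlUVOSLegsFromFemtoAndGapStubAssemblyShiftedWeights
import HarnessLib

/-!
# Soft OS-assembly toolkit X-b: the a-uniform bound for ABSTRACT weights at SHIFTED evaluation points

Helper file for stub `stub_assembly6` of crux `OSLegsFromFemtoAndGap` (stmt-QuantumFields-9367, line
`dlr-collar-transfer`, reshape r2).  Toolkit VI-b/VI-c bound `Σₓ W(x) F(a x)` for the centred moments `W` of the
action density.  The reflection-positivity blocks need the same bound (i) for the centred mixed moments of plane
STRINGS (any weight `W` with a sup bound `Mⁿ` and the collar bound `(C/R⁴)ⁿ` at torus-separated sites), and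
(ii) with the test function evaluated at SHIFTED points `y(x)`, `‖y(x)_l − a x_l‖ ≤ s a` (lattice reflections act on
plaquette strings only up to per-argument one-step shifts).  This file proves exactly that:
`norm_sum_weight_mul_le` — for `F ∈ ⁰𝒮ₙ` (`n ≥ 2`), `0 < a ≤ 1`, `s a ≤ 1/4`, `0 ≤ s ≤ 6`, `a ≤ ℓ₄`, `L ≥ 14`,
`L ≥ a⁻²`:  `‖Σ_{x ∈ (box L)ⁿ} W(x) F(y(x))‖ ≤ Kⁿ (S₀,₄ₙ + S₆ₙ,₄ₙ + S₀,₀ + S₆ₙ,₀ + S₁₀ₙ,₀)(F)` with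
`K = (M 4⁴5⁶ + M 2⁶(10+2s)⁴ + 16C 2⁶(2/ℓ₄+48)⁴) · 2⁶ · 81 Σ (m+1)⁻²`.
-/

noncomputable section

open scoped SchwartzMap BigOperators
open MeasureTheory Filter Topology
open Literature.MathematicalPhysics.QuantumFieldTheory Literature.MathematicalPhysics.QuantumLattice
open Literature.MathematicalPhysics.AQFT
open Literature.Probability.LatticeModels (box Site)

namespace Summit.QuantumFields.YangMills.Theorems.OSLegsFromFemtoAndGap

local notation "E4" => EuclideanSpace ℝ (Fin 4)

variable {n : ℕ}

/-! ### Summation -/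

/-- `((1 + ‖y‖)^p)⁻ⁿ ≤ ∏ᵢ (2^p ((1 + a‖xᵢ‖)^p)⁻¹)` when `a‖xᵢ‖ ≤ ‖yᵢ‖ + 1/2`. -/
theorem inv_one_add_norm_pow_le_prod' {a : ℝ} (ha : 0 ≤ a) (x : Fin n → Site 4) (y : Fin n → E4)
    (hy : ∀ i, a * ‖x i‖ ≤ ‖y i‖ + 1 / 2) (p : ℕ) :
    (((1 + ‖y‖) ^ p)⁻¹) ^ n ≤ ∏ i, (2 ^ p * ((1 + a * ‖x i‖) ^ p)⁻¹) := by
  calc (((1 + ‖y‖) ^ p)⁻¹) ^ n = ∏ _i : Fin n, ((1 + ‖y‖) ^ p)⁻¹ := by simp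
    _ ≤ ∏ i, (2 ^ p * ((1 + a * ‖x i‖) ^ p)⁻¹) := Finset.prod_le_prod (fun _ _ => by positivity) fun i _ => by
        have hi : 1 + a * ‖x i‖ ≤ 2 * (1 + ‖y‖) := by
          have h1 := norm_le_pi_norm y i
          have h2 : 0 ≤ a * ‖x i‖ := by positivity
          linarith [hy i, norm_nonneg y]
        have hpos : 0 < 1 + a * ‖x i‖ := by positivity
        rw [← inv_pow, ← inv_pow, ← mul_pow]
        refine pow_le_pow_left₀ (by positivity) ?_ p
        rw [show (2 : ℝ) * (1 + a * ‖x i‖)⁻¹ = ((1 + a * ‖x i‖) / 2)⁻¹ by rw [inv_div]; ring]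
        exact inv_anti₀ (by positivity) (by linarith)

/-- **Per-point bound with the summable lattice weight.**  `|W(x)| ‖F(y(x))‖ ≤ K₀ⁿ Σ(F) ∏ₗ 2⁶ a⁴ (1 + a‖xₗ‖)⁻⁶`
(`K₀` the per-point constant of `pointwise_bound'`). -/
theorem abs_weight_mul_norm_le_prod {C ℓ₄ M a s : ℝ} {L n : ℕ} (hℓ : 0 < ℓ₄) (hC : 0 ≤ C) (hM : 0 ≤ M)
    (W : (Fin n → Site 4) → ℝ) (hWsup : ∀ x, |W x| ≤ M ^ n)
    (H : ∀ (x : Fin n → Site 4) (R : ℕ), 1 ≤ R → (R : ℝ) * a ≤ ℓ₄ → 4 * R + 8 ≤ L →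
      (∀ i j : Fin n, i ≠ j → ∃ k : Fin 4,
        (2 * (R : ℤ) + 4) ≤ |((((x i k - x j k : ℤ) : ZMod (2 * L + 1))).valMinAbs : ℤ)|) →
      |W x| ≤ (C / (R : ℝ) ^ 4) ^ n)
    (ha : 0 < a) (ha1 : a ≤ 1) (haℓ : a ≤ ℓ₄) (hL14 : 14 ≤ L) (hLa : a⁻¹ * a⁻¹ ≤ L) (hn : 2 ≤ n)
    (hs : 0 ≤ s) (hs6 : s ≤ 6) (hsa : s * a ≤ 1 / 4)
    (F : 𝓢((Fin n → E4), ℂ)) (hF : IsOffDiagonal F) (x : Fin n → Site 4)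
    (y : Fin n → E4) (hyx : ∀ l, ‖y l - a • siteToE (x l)‖ ≤ s * a) :
    |W x| * ‖F y‖ ≤
      (M * 4 ^ 4 * 5 ^ 6 + M * 2 ^ 6 * (10 + 2 * s) ^ 4 + 16 * C * 2 ^ 6 * (2 / ℓ₄ + 48) ^ 4) ^ n *
        (SchwartzMap.seminorm ℂ 0 (4 * n) F + SchwartzMap.seminorm ℂ (6 * n) (4 * n) F +
          SchwartzMap.seminorm ℂ 0 0 F + SchwartzMap.seminorm ℂ (6 * n) 0 F +
          SchwartzMap.seminorm ℂ (10 * n) 0 F) *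
        ∏ i, (2 ^ 6 * (a ^ 4 * ((1 + a * ‖x i‖) ^ 6)⁻¹)) := by
  set K₀ : ℝ := M * 4 ^ 4 * 5 ^ 6 + M * 2 ^ 6 * (10 + 2 * s) ^ 4 + 16 * C * 2 ^ 6 * (2 / ℓ₄ + 48) ^ 4
  set Ssum := SchwartzMap.seminorm ℂ 0 (4 * n) F + SchwartzMap.seminorm ℂ (6 * n) (4 * n) F +
    SchwartzMap.seminorm ℂ 0 0 F + SchwartzMap.seminorm ℂ (6 * n) 0 F + SchwartzMap.seminorm ℂ (10 * n) 0 F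
  have hq : 0 < (1 + ‖y‖) ^ (6 * n) := by positivity
  have h1 := pointwise_bound' hℓ hC hM W hWsup H ha ha1 haℓ hL14 hLa hn hs hs6 hsa F hF x y hyx
  have h2 : |W x| * ‖F y‖ ≤ K₀ ^ n * a ^ (4 * n) * Ssum * ((1 + ‖y‖) ^ (6 * n))⁻¹ := by
    rw [← div_eq_mul_inv, le_div_iff₀ hq]; exact h1
  have hyhalf : ∀ i, a * ‖x i‖ ≤ ‖y i‖ + 1 / 2 := fun i => by
    have := norm_ge_of_shift ha.le hyx i
    linarith
  have h3 : ((1 + ‖y‖) ^ (6 * n))⁻¹ ≤ ∏ i, (2 ^ 6 * ((1 + a * ‖x i‖) ^ 6)⁻¹) := by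
    have := inv_one_add_norm_pow_le_prod' ha.le x y hyhalf 6
    rw [inv_pow, ← pow_mul] at this
    exact this
  have h4 : a ^ (4 * n) * ∏ i, (2 ^ 6 * ((1 + a * ‖x i‖) ^ 6)⁻¹) =
      ∏ i, (2 ^ 6 * (a ^ 4 * ((1 + a * ‖x i‖) ^ 6)⁻¹)) := by
    simp only [Finset.prod_mul_distrib, Finset.prod_const, Finset.card_univ, Fintype.card_fin]
    ring
  calc |W x| * ‖F y‖ ≤ K₀ ^ n * a ^ (4 * n) * Ssum * ((1 + ‖y‖) ^ (6 * n))⁻¹ := h2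
    _ ≤ K₀ ^ n * a ^ (4 * n) * Ssum * ∏ i, (2 ^ 6 * ((1 + a * ‖x i‖) ^ 6)⁻¹) := by gcongr
    _ = K₀ ^ n * Ssum * (a ^ (4 * n) * ∏ i, (2 ^ 6 * ((1 + a * ‖x i‖) ^ 6)⁻¹)) := by ring
    _ = K₀ ^ n * Ssum * ∏ i, (2 ^ 6 * (a ^ 4 * ((1 + a * ‖x i‖) ^ 6)⁻¹)) := by rw [h4]

/-- **The a-uniform ABSOLUTE bound for abstract weights at shifted points** (so every sub-sum obeys it too).
`y x` is any evaluation point with `‖(y x)_l − a x_l‖ ≤ s a`; `W` any weight with sup bound `Mⁿ` and collar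
bound `(C/R⁴)ⁿ`. -/
theorem sum_abs_weight_mul_norm_le {C ℓ₄ M a s : ℝ} {L n : ℕ} (hℓ : 0 < ℓ₄) (hC : 0 ≤ C) (hM : 0 ≤ M)
    (W : (Fin n → Site 4) → ℝ) (hWsup : ∀ x, |W x| ≤ M ^ n)
    (H : ∀ (x : Fin n → Site 4) (R : ℕ), 1 ≤ R → (R : ℝ) * a ≤ ℓ₄ → 4 * R + 8 ≤ L →
      (∀ i j : Fin n, i ≠ j → ∃ k : Fin 4,
        (2 * (R : ℤ) + 4) ≤ |((((x i k - x j k : ℤ) : ZMod (2 * L + 1))).valMinAbs : ℤ)|) →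
      |W x| ≤ (C / (R : ℝ) ^ 4) ^ n)
    (ha : 0 < a) (ha1 : a ≤ 1) (haℓ : a ≤ ℓ₄) (hL14 : 14 ≤ L) (hLa : a⁻¹ * a⁻¹ ≤ L) (hn : 2 ≤ n)
    (hs : 0 ≤ s) (hs6 : s ≤ 6) (hsa : s * a ≤ 1 / 4)
    (F : 𝓢((Fin n → E4), ℂ)) (hF : IsOffDiagonal F)
    (y : (Fin n → Site 4) → (Fin n → E4)) (hyx : ∀ x l, ‖y x l - a • siteToE (x l)‖ ≤ s * a) :
    ∑ x ∈ Fintype.piFinset (fun _ : Fin n => box 4 L), |W x| * ‖F (y x)‖ ≤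
      ((M * 4 ^ 4 * 5 ^ 6 + M * 2 ^ 6 * (10 + 2 * s) ^ 4 + 16 * C * 2 ^ 6 * (2 / ℓ₄ + 48) ^ 4) * 2 ^ 6 *
          (81 * ∑' m : ℕ, (((m : ℝ) + 1) ^ 2)⁻¹)) ^ n *
        (SchwartzMap.seminorm ℂ 0 (4 * n) F + SchwartzMap.seminorm ℂ (6 * n) (4 * n) F +
          SchwartzMap.seminorm ℂ 0 0 F + SchwartzMap.seminorm ℂ (6 * n) 0 F +
          SchwartzMap.seminorm ℂ (10 * n) 0 F) := by
  classical
  obtain ⟨K₀, hK₀⟩ : ∃ K₀ : ℝ,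
      M * 4 ^ 4 * 5 ^ 6 + M * 2 ^ 6 * (10 + 2 * s) ^ 4 + 16 * C * 2 ^ 6 * (2 / ℓ₄ + 48) ^ 4 = K₀ := ⟨_, rfl⟩
  obtain ⟨Z, hZ⟩ : ∃ Z : ℝ, 81 * ∑' m : ℕ, (((m : ℝ) + 1) ^ 2)⁻¹ = Z := ⟨_, rfl⟩
  have hZ0 : 0 ≤ Z := by rw [← hZ]; exact mul_nonneg (by norm_num) (tsum_nonneg fun m => by positivity)
  have hK₀0 : 0 ≤ K₀ := by rw [← hK₀]; positivity
  set Ssum := SchwartzMap.seminorm ℂ 0 (4 * n) F + SchwartzMap.seminorm ℂ (6 * n) (4 * n) F +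
    SchwartzMap.seminorm ℂ 0 0 F + SchwartzMap.seminorm ℂ (6 * n) 0 F + SchwartzMap.seminorm ℂ (10 * n) 0 F
    with hSsum
  have hSsum0 : 0 ≤ Ssum := by positivity
  have hpt : ∀ x : Fin n → Site 4, |W x| * ‖F (y x)‖ ≤
      K₀ ^ n * Ssum * ∏ i, (2 ^ 6 * (a ^ 4 * ((1 + a * ‖x i‖) ^ 6)⁻¹)) := fun x => by
    have h := abs_weight_mul_norm_le_prod hℓ hC hM W hWsup H ha ha1 haℓ hL14 hLa hn hs hs6 hsa F hF x (y x) (hyx x)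
    rw [hK₀] at h; exact h
  have hsumZ : ∑ x ∈ Fintype.piFinset (fun _ : Fin n => box 4 L),
      ∏ i, (2 ^ 6 * (a ^ 4 * ((1 + a * ‖x i‖) ^ 6)⁻¹)) ≤ (2 ^ 6 * Z) ^ n := by
    have hfac : ∀ x : Fin n → Site 4, ∏ i, (2 ^ 6 * (a ^ 4 * ((1 + a * ‖x i‖) ^ 6)⁻¹)) =
        (2 : ℝ) ^ (6 * n) * ∏ i, (a ^ 4 * ((1 + a * ‖x i‖) ^ 6)⁻¹) := fun x => by
      rw [Finset.prod_mul_distrib, Finset.prod_const, Finset.card_univ, Fintype.card_fin, ← pow_mul]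
    simp_rw [hfac]
    rw [← Finset.mul_sum, mul_pow, ← pow_mul]
    gcongr
    rw [← hZ]; exact sum_prod_decay_le ha ha1 (le_refl 6) (box 4 L) n
  rw [hK₀, hZ]
  calc ∑ x ∈ Fintype.piFinset (fun _ : Fin n => box 4 L), |W x| * ‖F (y x)‖
      ≤ ∑ x ∈ Fintype.piFinset (fun _ : Fin n => box 4 L),
        K₀ ^ n * Ssum * ∏ i, (2 ^ 6 * (a ^ 4 * ((1 + a * ‖x i‖) ^ 6)⁻¹)) := Finset.sum_le_sum fun x _ => hpt x
    _ = K₀ ^ n * Ssum * ∑ x ∈ Fintype.piFinset (fun _ : Fin n => box 4 L),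
        ∏ i, (2 ^ 6 * (a ^ 4 * ((1 + a * ‖x i‖) ^ 6)⁻¹)) := by rw [Finset.mul_sum]
    _ ≤ K₀ ^ n * Ssum * (2 ^ 6 * Z) ^ n :=
        mul_le_mul_of_nonneg_left hsumZ (mul_nonneg (pow_nonneg hK₀0 n) hSsum0)
    _ = (K₀ * 2 ^ 6 * Z) ^ n * Ssum := by rw [mul_pow, mul_pow, mul_pow]; ring

/-- **The a-uniform bound for abstract weights at shifted points.**  `y x` is any evaluation point with
`‖(y x)_l − a x_l‖ ≤ s a`; `W` any weight with sup bound `Mⁿ` and collar bound `(C/R⁴)ⁿ`. -/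
theorem norm_sum_weight_mul_le {C ℓ₄ M a s : ℝ} {L n : ℕ} (hℓ : 0 < ℓ₄) (hC : 0 ≤ C) (hM : 0 ≤ M)
    (W : (Fin n → Site 4) → ℝ) (hWsup : ∀ x, |W x| ≤ M ^ n)
    (H : ∀ (x : Fin n → Site 4) (R : ℕ), 1 ≤ R → (R : ℝ) * a ≤ ℓ₄ → 4 * R + 8 ≤ L →
      (∀ i j : Fin n, i ≠ j → ∃ k : Fin 4,
        (2 * (R : ℤ) + 4) ≤ |((((x i k - x j k : ℤ) : ZMod (2 * L + 1))).valMinAbs : ℤ)|) →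
      |W x| ≤ (C / (R : ℝ) ^ 4) ^ n)
    (ha : 0 < a) (ha1 : a ≤ 1) (haℓ : a ≤ ℓ₄) (hL14 : 14 ≤ L) (hLa : a⁻¹ * a⁻¹ ≤ L) (hn : 2 ≤ n)
    (hs : 0 ≤ s) (hs6 : s ≤ 6) (hsa : s * a ≤ 1 / 4)
    (F : 𝓢((Fin n → E4), ℂ)) (hF : IsOffDiagonal F)
    (y : (Fin n → Site 4) → (Fin n → E4)) (hyx : ∀ x l, ‖y x l - a • siteToE (x l)‖ ≤ s * a) :
    ‖∑ x ∈ Fintype.piFinset (fun _ : Fin n => box 4 L), ((W x : ℝ) : ℂ) * F (y x)‖ ≤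
      ((M * 4 ^ 4 * 5 ^ 6 + M * 2 ^ 6 * (10 + 2 * s) ^ 4 + 16 * C * 2 ^ 6 * (2 / ℓ₄ + 48) ^ 4) * 2 ^ 6 *
          (81 * ∑' m : ℕ, (((m : ℝ) + 1) ^ 2)⁻¹)) ^ n *
        (SchwartzMap.seminorm ℂ 0 (4 * n) F + SchwartzMap.seminorm ℂ (6 * n) (4 * n) F +
          SchwartzMap.seminorm ℂ 0 0 F + SchwartzMap.seminorm ℂ (6 * n) 0 F +
          SchwartzMap.seminorm ℂ (10 * n) 0 F) := by
  refine le_trans ?_ (sum_abs_weight_mul_norm_le hℓ hC hM W hWsup H ha ha1 haℓ hL14 hLa hn hs hs6 hsa F hF y hyx)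
  refine (norm_sum_le _ _).trans (le_of_eq (Finset.sum_congr rfl fun x _ => ?_))
  rw [norm_mul, Complex.norm_real, Real.norm_eq_abs]

end Summit.QuantumFields.YangMills.Theorems.OSLegsFromFemtoAndGap

end
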